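import Mathlib
import HarnessLib
import Summits.ValiantsHypothesis.ValiantsHypothesis.Theorems.MonotoneRestorationOrbitRestorationQPMultisymmetricPowerSums

/-!
# Row-invariant polynomials in the row atoms of a column core are polynomials in the super-atoms

Route MonotoneRestoration, crux `OrbitRestorationQP` (stmt-ValiantsHypothesis-18293), SPAN-currency lane of the open
sub-rung A_∞ (`stub_sigmaPiSigmaValue`), `ΠΣ` part; the bridge between the multisymmetric first fundamental theorem
(`MultisymmetricPowerSums.mem_adjoin_powerSums_of_rowSymmetric_complex`) and the super-atom engine
(`Theorems/…SuperAtoms.lean`).  Helper (`--supports`), def-free.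

For a placed column core `ψ : Fin c → [n]` the ROW ATOMS of row `a` are `x_{a, ψ b}` (`b < c`) and the row sum `R_a`
(index type `κ = Fin c ⊕ Unit`); the evaluation `ev_ψ : ℂ[y_{a,k} : a < n, k ∈ κ] → ℂ[x]`, `y_{a, inl b} ↦ x_{a, ψ b}`,
`y_{a, inr ()} ↦ R_a`, sends the polarized power sum `F_γ = Σ_a Π_k y_{a,k}^{γ k}` to the SUPER-ATOM `S_γ(ψ)`.

* `rename_row_evalRowAtoms` — `ev_ψ` is equivariant for the row renamings;
* `evalRowAtoms_powerSum` — `ev_ψ (F_γ) = S_γ(ψ)`;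
* `exists_aeval_superAtoms_of_rowSymmetric_src` — if `P₀ ∈ ℂ[y]` is row-symmetric then `ev_ψ P₀ = aeval (S_•(ψ)) Q`
  for some `Q ∈ MvPolynomial (κ → ℕ) ℂ` (first fundamental theorem + `Algebra.adjoin_range_eq_range_aeval`);
* `evalRowAtoms_injective` — for `ψ` injective and `c < n`, `ev_ψ` is injective (explicit left inverse using a column
  `j₀ ∉ range ψ` to recover `y_{a, inr ()}`);
* **`exists_aeval_superAtoms_of_rowSymmetric`** — for `ψ` injective and `c < n`: every ROW-INVARIANT polynomial of
  `ℂ[x]` of the form `ev_ψ P₀` (i.e. every row-invariant polynomial in the atoms `x_{a,ψ b}`, `R_a`, in particular every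
  row-invariant polynomial in `x_{a, ψ b}`, `R_a`, `C_{ψ b}`, `U`) is a polynomial in the super-atoms placed at `ψ`.

Why (lane note): the column-label groupings `G_T` of the sign-twisted support blocks are products of local affine
forms with column core `T`; `G_T²` and `G_T · G_{T'}` are row-invariant, hence — by this file — super-atom polynomials,
which the super-atom engine places in `span_ℂ {hom_{F,n} : tw F ≤ |T ∪ T'| + 1}`.  No registered stub is closed; the
crux and VP ≠ VNP are not moved. [folklore; cite: Weyl1939, Chap. II §3, Thm (2.3.A); DwivediPagoSeppelt2026, §8]
-/

noncomputable section

-- `Summit.ValiantsHypothesis.ValiantsHypothesis.…` is the tree's single-conjunct layout (Sub = Summit).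
set_option linter.dupNamespace false

namespace Summit.ValiantsHypothesis.ValiantsHypothesis.Theorems

namespace SuperAtoms

open MvPolynomial Finset Equiv

/-! ### The evaluation at the row atoms -/

/-- **Row equivariance of the evaluation at the row atoms.** [folklore] -/
theorem rename_row_evalRowAtoms (n c : ℕ) (ψ : Fin c → Fin n) (σ : Perm (Fin n))
    (P₀ : MvPolynomial (Fin n × (Fin c ⊕ Unit)) ℂ) :
    rename (fun P : Fin n × Fin n => (σ P.1, P.2))
      (aeval (fun w : Fin n × (Fin c ⊕ Unit) =>
        Sum.elim (fun b : Fin c => (X (w.1, ψ b) : MvPolynomial (Fin n × Fin n) ℂ))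
          (fun _ : Unit => ∑ j : Fin n, (X (w.1, j) : MvPolynomial (Fin n × Fin n) ℂ)) w.2) P₀) =
    aeval (fun w : Fin n × (Fin c ⊕ Unit) =>
        Sum.elim (fun b : Fin c => (X (w.1, ψ b) : MvPolynomial (Fin n × Fin n) ℂ))
          (fun _ : Unit => ∑ j : Fin n, (X (w.1, j) : MvPolynomial (Fin n × Fin n) ℂ)) w.2)
      (rename (fun w : Fin n × (Fin c ⊕ Unit) => (σ w.1, w.2)) P₀) := by
  rw [aeval_rename, ← AlgHom.comp_apply, comp_aeval]
  congr 1
  refine MvPolynomial.algHom_ext fun w => ?_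
  rw [aeval_X, aeval_X]
  rcases w with ⟨a, b | u⟩
  · simp only [Function.comp_apply, Sum.elim_inl, rename_X]
  · simp only [Function.comp_apply, Sum.elim_inr, map_sum, rename_X]

/-- **The evaluation sends the polarized power sum `F_γ` to the super-atom `S_γ(ψ)`.** [folklore] -/
theorem evalRowAtoms_powerSum (n c : ℕ) (ψ : Fin c → Fin n) (γ : (Fin c ⊕ Unit) → ℕ) :
    aeval (fun w : Fin n × (Fin c ⊕ Unit) =>
        Sum.elim (fun b : Fin c => (X (w.1, ψ b) : MvPolynomial (Fin n × Fin n) ℂ))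
          (fun _ : Unit => ∑ j : Fin n, (X (w.1, j) : MvPolynomial (Fin n × Fin n) ℂ)) w.2)
      (∑ a : Fin n, ∏ k : Fin c ⊕ Unit, (X (a, k) : MvPolynomial (Fin n × (Fin c ⊕ Unit)) ℂ) ^ γ k) =
    ∑ a : Fin n, ∏ k : Fin c ⊕ Unit,
      (Sum.elim (fun b : Fin c => (X (a, ψ b) : MvPolynomial (Fin n × Fin n) ℂ))
        (fun _ : Unit => ∑ j : Fin n, (X (a, j) : MvPolynomial (Fin n × Fin n) ℂ)) k) ^ γ k := by
  simp only [map_sum, map_prod, map_pow, aeval_X]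

/-- **Row-symmetric source polynomials evaluate to super-atom polynomials** (first fundamental theorem for
multisymmetric polynomials). [cite: Weyl1939, Chap. II §3, Thm (2.3.A)] -/
theorem exists_aeval_superAtoms_of_rowSymmetric_src (n c : ℕ) (ψ : Fin c → Fin n)
    (P₀ : MvPolynomial (Fin n × (Fin c ⊕ Unit)) ℂ)
    (hP₀ : ∀ σ : Perm (Fin n), rename (fun w : Fin n × (Fin c ⊕ Unit) => (σ w.1, w.2)) P₀ = P₀) :
    ∃ Q : MvPolynomial ((Fin c ⊕ Unit) → ℕ) ℂ,
      aeval (fun w : Fin n × (Fin c ⊕ Unit) =>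
        Sum.elim (fun b : Fin c => (X (w.1, ψ b) : MvPolynomial (Fin n × Fin n) ℂ))
          (fun _ : Unit => ∑ j : Fin n, (X (w.1, j) : MvPolynomial (Fin n × Fin n) ℂ)) w.2) P₀ =
      aeval (fun γ : (Fin c ⊕ Unit) → ℕ => ∑ a : Fin n, ∏ k : Fin c ⊕ Unit,
        (Sum.elim (fun b : Fin c => (X (a, ψ b) : MvPolynomial (Fin n × Fin n) ℂ))
          (fun _ : Unit => ∑ j : Fin n, (X (a, j) : MvPolynomial (Fin n × Fin n) ℂ)) k) ^ γ k) Q := by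
  have hmem := MultisymmetricPowerSums.mem_adjoin_powerSums_of_rowSymmetric_complex P₀ hP₀
  rw [Algebra.adjoin_range_eq_range_aeval, AlgHom.mem_range] at hmem
  obtain ⟨Q, hQ⟩ := hmem
  refine ⟨Q, ?_⟩
  rw [← hQ, ← AlgHom.comp_apply, comp_aeval]
  congr 1
  refine MvPolynomial.algHom_ext fun γ => ?_
  rw [aeval_X, aeval_X]
  exact evalRowAtoms_powerSum n c ψ γ

/-! ### Injectivity of the evaluation -/

/-- **The evaluation at the row atoms of an injectively placed proper column core is injective**: a left inverse
reads `y_{a, inl b}` off `x_{a, ψ b}` and `y_{a, inr ()}` off the column `j₀ ∉ range ψ`. [folklore] -/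
theorem evalRowAtoms_injective (n c : ℕ) (ψ : Fin c → Fin n) (hψ : Function.Injective ψ) (hc : c < n) :
    Function.Injective (aeval (R := ℂ) (fun w : Fin n × (Fin c ⊕ Unit) =>
        Sum.elim (fun b : Fin c => (X (w.1, ψ b) : MvPolynomial (Fin n × Fin n) ℂ))
          (fun _ : Unit => ∑ j : Fin n, (X (w.1, j) : MvPolynomial (Fin n × Fin n) ℂ)) w.2)) := by
  classical
  -- a column outside the core
  obtain ⟨j₀, hj₀⟩ : ∃ j₀ : Fin n, ∀ b, ψ b ≠ j₀ := by
    have hns : ¬ Function.Surjective ψ := by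
      intro hsurj
      have := Fintype.card_le_of_surjective ψ hsurj
      simp only [Fintype.card_fin] at this
      omega
    simpa only [Function.Surjective, not_forall, not_exists] using hns
  -- the left inverse
  set back : MvPolynomial (Fin n × Fin n) ℂ →ₐ[ℂ] MvPolynomial (Fin n × (Fin c ⊕ Unit)) ℂ :=
    aeval (fun P : Fin n × Fin n =>
      (∑ b : Fin c, if ψ b = P.2 then (X (P.1, Sum.inl b) : MvPolynomial (Fin n × (Fin c ⊕ Unit)) ℂ) else 0) +
      (if P.2 = j₀ then (X (P.1, Sum.inr ()) : MvPolynomial (Fin n × (Fin c ⊕ Unit)) ℂ) -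
        ∑ b : Fin c, (X (P.1, Sum.inl b) : MvPolynomial (Fin n × (Fin c ⊕ Unit)) ℂ) else 0)) with hback
  have hleft : ∀ P₀ : MvPolynomial (Fin n × (Fin c ⊕ Unit)) ℂ,
      back (aeval (fun w : Fin n × (Fin c ⊕ Unit) =>
        Sum.elim (fun b : Fin c => (X (w.1, ψ b) : MvPolynomial (Fin n × Fin n) ℂ))
          (fun _ : Unit => ∑ j : Fin n, (X (w.1, j) : MvPolynomial (Fin n × Fin n) ℂ)) w.2) P₀) = P₀ := by
    intro P₀
    rw [← AlgHom.comp_apply]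
    conv_rhs => rw [← AlgHom.id_apply (R := ℂ) P₀]
    congr 1
    refine MvPolynomial.algHom_ext fun w => ?_
    rw [AlgHom.comp_apply, aeval_X, AlgHom.id_apply]
    rcases w with ⟨a, b | u⟩
    · simp only [Sum.elim_inl, hback, aeval_X, hj₀ b, if_false, add_zero]
      rw [Finset.sum_eq_single b]
      · rw [if_pos rfl]
      · intro b' _ hb'
        rw [if_neg (fun h => hb' (hψ h))]
      · intro h; exact absurd (Finset.mem_univ b) h
    · simp only [Sum.elim_inr, hback, map_sum, aeval_X]
      rw [Finset.sum_add_distrib, Finset.sum_comm, Fintype.sum_ite_eq' j₀]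
      have h1 : ∀ b : Fin c, (∑ j : Fin n, if ψ b = j then
          (X (a, Sum.inl b) : MvPolynomial (Fin n × (Fin c ⊕ Unit)) ℂ) else 0) = X (a, Sum.inl b) := by
        intro b
        rw [Fintype.sum_ite_eq (ψ b)]
      simp_rw [h1]
      abel
  intro P₁ P₂ h
  have := congrArg back h
  rwa [hleft, hleft] at this

/-- **ROW-INVARIANT POLYNOMIALS IN THE ROW ATOMS ARE SUPER-ATOM POLYNOMIALS.**  Let `ψ : Fin c → [n]` be injective with
`c < n`.  Every row-invariant polynomial of `ℂ[x_{pq}]` that is a polynomial in the atoms `x_{a, ψ b}`, `R_a` (`a < n`,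
`b < c`) is `aeval (S_•(ψ)) Q` for a polynomial `Q` in the super-atoms `S_γ(ψ) = Σ_a Π_b x_{a,ψ b}^{γ (inl b)} R_a^{γ (inr ())}`.
[cite: Weyl1939, Chap. II §3, Thm (2.3.A)] -/
theorem exists_aeval_superAtoms_of_rowSymmetric (n c : ℕ) (ψ : Fin c → Fin n) (hψ : Function.Injective ψ)
    (hc : c < n) (P₀ : MvPolynomial (Fin n × (Fin c ⊕ Unit)) ℂ)
    (hsymm : ∀ σ : Perm (Fin n), rename (fun P : Fin n × Fin n => (σ P.1, P.2))
      (aeval (fun w : Fin n × (Fin c ⊕ Unit) =>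
        Sum.elim (fun b : Fin c => (X (w.1, ψ b) : MvPolynomial (Fin n × Fin n) ℂ))
          (fun _ : Unit => ∑ j : Fin n, (X (w.1, j) : MvPolynomial (Fin n × Fin n) ℂ)) w.2) P₀) =
      aeval (fun w : Fin n × (Fin c ⊕ Unit) =>
        Sum.elim (fun b : Fin c => (X (w.1, ψ b) : MvPolynomial (Fin n × Fin n) ℂ))
          (fun _ : Unit => ∑ j : Fin n, (X (w.1, j) : MvPolynomial (Fin n × Fin n) ℂ)) w.2) P₀) :
    ∃ Q : MvPolynomial ((Fin c ⊕ Unit) → ℕ) ℂ,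
      aeval (fun w : Fin n × (Fin c ⊕ Unit) =>
        Sum.elim (fun b : Fin c => (X (w.1, ψ b) : MvPolynomial (Fin n × Fin n) ℂ))
          (fun _ : Unit => ∑ j : Fin n, (X (w.1, j) : MvPolynomial (Fin n × Fin n) ℂ)) w.2) P₀ =
      aeval (fun γ : (Fin c ⊕ Unit) → ℕ => ∑ a : Fin n, ∏ k : Fin c ⊕ Unit,
        (Sum.elim (fun b : Fin c => (X (a, ψ b) : MvPolynomial (Fin n × Fin n) ℂ))
          (fun _ : Unit => ∑ j : Fin n, (X (a, j) : MvPolynomial (Fin n × Fin n) ℂ)) k) ^ γ k) Q := by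
  refine exists_aeval_superAtoms_of_rowSymmetric_src n c ψ P₀ fun σ => ?_
  apply evalRowAtoms_injective n c ψ hψ hc
  rw [← rename_row_evalRowAtoms]
  exact hsymm σ

/-- **Row-(anti)symmetric pairs.**  If `ev_ψ P₁` and `ev_ψ P₂` are both relative row-invariants with the same `±1`-valued
multiplier (`σ · G_i = ε(σ) G_i`, `ε(σ)² = 1`), then the product `ev_ψ (P₁ P₂)` is row-invariant, hence a super-atom
polynomial (the Gram / pairing step of the sign-twisted lane). [folklore] -/
theorem exists_aeval_superAtoms_of_relInvariant_pair (n c : ℕ) (ψ : Fin c → Fin n) (hψ : Function.Injective ψ)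
    (hc : c < n) (P₁ P₂ : MvPolynomial (Fin n × (Fin c ⊕ Unit)) ℂ) (ε : Perm (Fin n) → ℂ)
    (hε : ∀ σ, ε σ * ε σ = 1)
    (h₁ : ∀ σ : Perm (Fin n), rename (fun P : Fin n × Fin n => (σ P.1, P.2))
      (aeval (fun w : Fin n × (Fin c ⊕ Unit) =>
        Sum.elim (fun b : Fin c => (X (w.1, ψ b) : MvPolynomial (Fin n × Fin n) ℂ))
          (fun _ : Unit => ∑ j : Fin n, (X (w.1, j) : MvPolynomial (Fin n × Fin n) ℂ)) w.2) P₁) =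
      C (ε σ) * aeval (fun w : Fin n × (Fin c ⊕ Unit) =>
        Sum.elim (fun b : Fin c => (X (w.1, ψ b) : MvPolynomial (Fin n × Fin n) ℂ))
          (fun _ : Unit => ∑ j : Fin n, (X (w.1, j) : MvPolynomial (Fin n × Fin n) ℂ)) w.2) P₁)
    (h₂ : ∀ σ : Perm (Fin n), rename (fun P : Fin n × Fin n => (σ P.1, P.2))
      (aeval (fun w : Fin n × (Fin c ⊕ Unit) =>
        Sum.elim (fun b : Fin c => (X (w.1, ψ b) : MvPolynomial (Fin n × Fin n) ℂ))
          (fun _ : Unit => ∑ j : Fin n, (X (w.1, j) : MvPolynomial (Fin n × Fin n) ℂ)) w.2) P₂) =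
      C (ε σ) * aeval (fun w : Fin n × (Fin c ⊕ Unit) =>
        Sum.elim (fun b : Fin c => (X (w.1, ψ b) : MvPolynomial (Fin n × Fin n) ℂ))
          (fun _ : Unit => ∑ j : Fin n, (X (w.1, j) : MvPolynomial (Fin n × Fin n) ℂ)) w.2) P₂) :
    ∃ Q : MvPolynomial ((Fin c ⊕ Unit) → ℕ) ℂ,
      aeval (fun w : Fin n × (Fin c ⊕ Unit) =>
        Sum.elim (fun b : Fin c => (X (w.1, ψ b) : MvPolynomial (Fin n × Fin n) ℂ))
          (fun _ : Unit => ∑ j : Fin n, (X (w.1, j) : MvPolynomial (Fin n × Fin n) ℂ)) w.2) (P₁ * P₂) =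
      aeval (fun γ : (Fin c ⊕ Unit) → ℕ => ∑ a : Fin n, ∏ k : Fin c ⊕ Unit,
        (Sum.elim (fun b : Fin c => (X (a, ψ b) : MvPolynomial (Fin n × Fin n) ℂ))
          (fun _ : Unit => ∑ j : Fin n, (X (a, j) : MvPolynomial (Fin n × Fin n) ℂ)) k) ^ γ k) Q := by
  refine exists_aeval_superAtoms_of_rowSymmetric n c ψ hψ hc (P₁ * P₂) fun σ => ?_
  rw [map_mul, map_mul, h₁ σ, h₂ σ]
  calc C (ε σ) * aeval _ P₁ * (C (ε σ) * aeval _ P₂)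
      = C (ε σ * ε σ) * (aeval _ P₁ * aeval _ P₂) := by rw [map_mul]; ring
    _ = aeval _ P₁ * aeval _ P₂ := by rw [hε σ, map_one, one_mul]

end SuperAtoms

end Summit.ValiantsHypothesis.ValiantsHypothesis.Theorems

end
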